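import Literature.AlgebraicGeometry.ComplexMultiplication.CurveTimesMultiquadraticCMWeights
import Literature.AlgebraicGeometry.Pohlmann1968.HodgeClassesProductSpanCMProductsSharp
import Literature.AlgebraicGeometry.Pohlmann1968.SimpleCMAbelianVarietyPowersDivisorGenerated
import Literature.AlgebraicGeometry.HodgeTheory.HodgeClassesProductSpanTransport
import HarnessLib

/-!
# The Weil classes of `k` on `E² × Y`: for `E` a CM elliptic curve inside an OCTIC multiquadratic CM field `K` of a
# nondegenerate `Y`, the square `E² × Y` does NOT have the product-span property (while `E × Y` does)

COR-CM (cell `pub-hodgecm2`, binder seat `b25` gen 35, count-neutral claim PRODSPAN-POWERS (F18)); NEW as stated, hence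
under `Summits/`.  Theorems only; no definition, no named fact, no `sorry`.  Sharpens `CorCM/CurveTimesMultiquadraticCMPowers`
("SOME `E^{a+1} × Y^{a+1}`") to the explicit exponent: for `[K:ℚ] = 8` (`Gal(K/ℚ) ≅ (ℤ/2)³`, e.g. `ℚ(ζ₂₄)`) already

  **`¬ HodgeClassesProductSpan (E.powSucc 1) Y`** (`not_hodgeClassesProductSpan_sq_curve_multiquadratic_octic`):

`E² × Y` carries a rational `(3,3)`-class (middle cohomology of the sixfold) which is not a `ℂ`-combination of exterior
products of Hodge classes of `E²` and of `Y`.  THE WITNESS.  Index `Hom(K,ℂ)` by `G = Gal(K/ℚ)` (`σ_g = φ₀ ∘ g⁻¹`,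
`φ₀` extending an embedding `x ∈ Φ_k` of `k` along `j`), let `H = Gal(K/j(k))` (`|H| = 4`, `ρ ∉ H`) and
`Ψ = {g | σ_g ∈ Φ}` the type on `G`.  Nondegeneracy forces `|Ψ ∩ H| ∈ {1, 3}` (the odd character `ε_H = ±1` of kernel `H`
has `Σ_Ψ ε_H = |Ψ ∩ H| − |Ψ ∩ ρH| ≠ 0`, and `Ψ ≠ H, ρH` since an odd character non-trivial on `H` would vanish on a coset).
Let `C ∈ {H, ρH}` be the coset with `|Ψ ∩ C| = 1` (so `|Ψ ∩ C'| = 3` for the other).  The `0/1`-weight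
`S = {(0,x), (1,x)} ⊔ {(0, σ_h) | h ∈ C}` of `E² × Y` (`|S| = 6`) is Galois balanced with value `3`: an automorphism
acting through `γ ∈ H` keeps `x` in `Φ_k` (count `2`) and contributes `|Ψ ∩ Cγ| = |Ψ ∩ C| = 1`; one acting through
`γ ∉ H` moves `x` to `x̄ ∉ Φ_k` (count `0`) and contributes `|Ψ ∩ C'| = 3`.  Its `E²`-block `{(0,x),(1,x)}` is NOT balanced
(`2 ≠ 0` at `τ = 1`), so by `Pohlmann1968.blocksSplit_of_hodgeClassesProductSpan_biproduct` the product-span property fails.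

## References
* [MoonenZarhin1999LowDim] B. Moonen, Yu. Zarhin, Math. Ann. 315 (1999) 711–733, §3 (3.1), Thm. (0.2) (Weil classes).
* [Deligne1982HodgeCycles] P. Deligne, *Hodge cycles on abelian varieties*, LNM 900 (1982), §4 (Weil classes).
* [Kubota1965] T. Kubota, Trans. AMS 118 (1965), §4 Lemma 2.

Provenance: Literature home (namespace `Literature.AlgebraicGeometry.ComplexMultiplication.Multiquadratic`) of the Summits-side `CorCM/CurveTimesMultiquadraticCMSquare` (cell `pub-hodgecm2`, COR-CM; all its imports are `Literature/`, Mathlib and the already re-homed `CurveTimesMultiquadraticCMWeights`), which `Literature/` may not import; theorems only, no named fact, no definition. Nothing here bears on `HC_CM`. Lane `lit-hodgefound` (Layer A3: CM types, their Kubota ranks and Galois combinatorics), seat p20.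
-/

noncomputable section

open _root_.CategoryTheory _root_.CategoryTheory.Limits NumberField

namespace Literature.AlgebraicGeometry.ComplexMultiplication.Multiquadratic

open Literature.AlgebraicGeometry.Motives (AbelianVariety CMType)
open Literature.AlgebraicGeometry.Motives.AbelianVariety
open Literature.AlgebraicGeometry.HodgeTheory
open Literature.AlgebraicGeometry.ComplexMultiplication (IsCMTypeRealisation)
open Literature.AlgebraicGeometry.Pohlmann1968
open Literature.NumberTheory.ComplexMultiplication

open scoped Classical

section Square

variable {k : Type} [Field k] [NumberField k]
  {K : Type} [Field K] [NumberField K] [Normal ℚ K]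
  {Φk : CMType k} {Φ : CMType K}
  {E Y : AbelianVariety ℂ} {ιE : 𝓞 k →+* End E} {ιY : 𝓞 K →+* End Y}
  {θE : k →+* Module.End ℂ (complexBetti E.X 1)} {θY : K →+* Module.End ℂ (complexBetti Y.X 1)}

/-- Reindexing a count along the involution `h ↦ hγ` of an exponent-`2` group. [cite: MoonenZarhin1999LowDim, §3 (3.1) and Thm. (0.2)] -/
private theorem card_filter_mul_eq {G : Type*} [CommGroup G] [Fintype G] (hexp : ∀ g : G, g * g = 1) (γ : G)
    (P Q : G → Prop) [DecidablePred fun h : G => P h ∧ Q (h * γ)] [DecidablePred fun g : G => P (g * γ) ∧ Q g] :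
    (Finset.univ.filter fun h : G => P h ∧ Q (h * γ)).card = (Finset.univ.filter fun g : G => P (g * γ) ∧ Q g).card := by
  have hinv : ∀ g : G, g * γ * γ = g := fun g => by rw [mul_assoc, hexp γ, mul_one]
  refine Finset.card_nbij' (fun h => h * γ) (fun g => g * γ) ?_ ?_ (fun h _ => hinv h) (fun g _ => hinv g)
  · intro h hh
    rw [Finset.mem_coe, Finset.mem_filter] at hh ⊢
    exact ⟨Finset.mem_univ _, by rw [hinv]; exact hh.2.1, hh.2.2⟩
  · intro g hg
    rw [Finset.mem_coe, Finset.mem_filter] at hg ⊢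
    exact ⟨Finset.mem_univ _, hg.2.1, by rw [hinv]; exact hg.2.2⟩

/-- **`E² × Y` does not have the product-span property** — `E` an elliptic curve with CM by the imaginary quadratic
field `k`, `Y` a NONDEGENERATE abelian fourfold with CM by an octic CM field `K ⊇ k`, normal over `ℚ` with commutative
Galois group of exponent `2` (e.g. `ℚ(ζ₂₄)`): some rational Hodge class on `E² × Y` (a Weil class of `k`, of type
`(3,3)`) is not a combination of exterior products — although every Hodge class on `E × Y` is
(`hodgeClassesProductSpan_curve_multiquadratic`). [cite: MoonenZarhin1999LowDim, §3 (3.1) and Thm. (0.2)]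
[cite: Deligne1982HodgeCycles, §4] -/
theorem not_hodgeClassesProductSpan_sq_curve_multiquadratic_octic (hk : Module.finrank ℚ k = 2) (j : k →+* K)
    (hcomm : ∀ g h : K ≃ₐ[ℚ] K, g * h = h * g) (hexp : ∀ g : K ≃ₐ[ℚ] K, g * g = 1) (h8 : Module.finrank ℚ K = 8)
    (hnd : IsNondegenerate Φ) (hE : IsCMTypeRealisation Φk E ιE θE) (hY : IsCMTypeRealisation Φ Y ιY θY) :
    ¬ HodgeClassesProductSpan (E.powSucc 1) Y := by
  intro hspan
  have hspan' : HodgeClassesProductSpan (⨁ fun _ : Fin 2 => E) (⨁ fun _ : Fin 1 => Y) :=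
    hspan.of_isIsogenous' (isIsogenous_powSucc_biproduct E 1) (isIsogenous_powSucc_biproduct Y 0)
  letI : CommGroup (K ≃ₐ[ℚ] K) := { (inferInstance : Group (K ≃ₐ[ℚ] K)) with mul_comm := hcomm }
  haveI : IsGalois ℚ K := ⟨⟩
  -- an embedding `x ∈ Φ_k` of `k` and a base embedding `φ₀` of `K` extending it
  obtain ⟨x, hxΦ⟩ : ∃ x : k →+* ℂ, x ∈ Φk.1 := by
    obtain ⟨ψ⟩ := (inferInstance : Nonempty (k →+* ℂ))
    by_cases hψ : ψ ∈ Φk.1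
    · exact ⟨ψ, hψ⟩
    · exact ⟨_, (conjugate_mem_iff Φk ψ).2 hψ⟩
  obtain ⟨ι₀⟩ := (inferInstance : Nonempty (K →+* ℂ))
  obtain ⟨g₀, hg₀⟩ := exists_eq_comp_algEquiv_comp (K := fun _ : Fin 1 => k) ι₀ (fun _ => j) 0 x
  set φ₀ : K →+* ℂ := ι₀.comp (g₀ : K →+* K) with hφ₀
  have hφ₀j : φ₀.comp j = x := by rw [hg₀]
  obtain ⟨ρ, hρ'⟩ := exists_algEquiv_comp_eq φ₀ (ComplexEmbedding.conjugate φ₀)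
  have hρ : ∀ y, φ₀ (ρ y) = starRingEnd ℂ (φ₀ y) := fun y => by rw [hρ' y]; rfl
  -- the type read on `G`, its CM property and nondegeneracy
  set Ψ : Finset (K ≃ₐ[ℚ] K) := Finset.univ.filter fun g : K ≃ₐ[ℚ] K => embOf φ₀ g ∈ Φ.1 with hΨdef
  have hmemΨ : ∀ g, g ∈ Ψ ↔ embOf φ₀ g ∈ Φ.1 := fun g => by rw [hΨdef, Finset.mem_filter]; simp
  have hΨ := isCMTypeWith_gal hcomm Φ φ₀ ρ hρ
  have hset : ({g : K ≃ₐ[ℚ] K | embOf φ₀ g ∈ Φ.1} : Set (K ≃ₐ[ℚ] K)) = ↑Ψ := by ext g; simp [hmemΨ]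
  rw [hset] at hΨ
  have hndχ := (isNondegenerate_iff_forall_oddCharacters hcomm Φ φ₀ ρ hρ).1 hnd
  -- `H = Gal(K/j(k))`, the dichotomy `g ∈ H ∨ ρg ∈ H`
  let H : Subgroup (K ≃ₐ[ℚ] K) :=
    { carrier := {g | ∀ y, g (j y) = j y}
      one_mem' := fun y => rfl
      mul_mem' := fun {g} {h} hg hh y => by
        show (g * h) (j y) = j y
        rw [AlgEquiv.mul_apply, hh, hg]
      inv_mem' := fun {g} hg => by
        have : g⁻¹ = g := inv_eq_of_mul_eq_one_right (hexp g)
        rw [this]; exact hg }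
  have hmemH : ∀ g : K ≃ₐ[ℚ] K, g ∈ H ↔ ∀ y, g (j y) = j y := fun g => Iff.rfl
  have hxne : ComplexEmbedding.conjugate x ≠ x := conjugate_ne_self Φk x
  have hρρ : ρ * ρ = 1 := hexp ρ
  have hcomp_apply : ∀ (g : K ≃ₐ[ℚ] K) (y : k), (φ₀.comp ((g : K →+* K).comp j)) y = φ₀ (g (j y)) := fun g y => by
    simp only [RingHom.coe_comp, Function.comp_apply, RingHom.coe_coe]
  have hxy : ∀ y : k, x y = φ₀ (j y) := fun y => by rw [← hφ₀j]; rfl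
  have hdich : ∀ g : K ≃ₐ[ℚ] K, (g ∈ H ∧ φ₀.comp ((g : K →+* K).comp j) = x) ∨
      (ρ * g ∈ H ∧ φ₀.comp ((g : K →+* K).comp j) = ComplexEmbedding.conjugate x) := by
    intro g
    rcases eq_or_eq_conjugate Φk hk x (φ₀.comp ((g : K →+* K).comp j)) with h | h
    · refine Or.inl ⟨(hmemH g).2 fun y => φ₀.injective ?_, h⟩
      rw [← hcomp_apply, h, hxy]
    · refine Or.inr ⟨(hmemH _).2 fun y => ?_, h⟩
      have h1 : φ₀ (g (j y)) = φ₀ (ρ (j y)) := by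
        rw [← hcomp_apply, h, ComplexEmbedding.conjugate_coe_eq, hxy, hρ]
      rw [AlgEquiv.mul_apply, φ₀.injective h1, ← AlgEquiv.mul_apply, hρρ, AlgEquiv.one_apply]
  have hρH : ρ ∉ H := by
    intro h
    apply hxne
    refine RingHom.ext fun y => ?_
    rw [ComplexEmbedding.conjugate_coe_eq, hxy, ← hρ, (hmemH ρ).1 h y]
  have hnotboth : ∀ g : K ≃ₐ[ℚ] K, g ∈ H → ρ * g ∉ H := by
    intro g hg hρg
    apply hρH
    have : ρ = ρ * g * g := by rw [mul_assoc, hexp g, mul_one]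
    rw [this]
    exact H.mul_mem hρg hg
  have hnotH : ∀ g : K ≃ₐ[ℚ] K, g ∉ H ↔ ρ * g ∈ H := fun g =>
    ⟨fun hg => ((hdich g).resolve_left fun h => hg h.1).1, fun h hg => hnotboth g hg h⟩
  -- parity: `gγ ∈ H ↔ (g ∈ H ↔ γ ∈ H)`
  have hpar : ∀ g γ : K ≃ₐ[ℚ] K, g * γ ∈ H ↔ (g ∈ H ↔ γ ∈ H) := by
    intro g γ
    by_cases hg : g ∈ H <;> by_cases hγ : γ ∈ H
    · exact ⟨fun _ => ⟨fun _ => hγ, fun _ => hg⟩, fun _ => H.mul_mem hg hγ⟩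
    · refine ⟨fun h => absurd ?_ hγ, fun h => absurd (h.1 hg) hγ⟩
      have : γ = g * (g * γ) := by rw [← mul_assoc, hexp g, one_mul]
      rw [this]; exact H.mul_mem hg h
    · refine ⟨fun h => absurd ?_ hg, fun h => absurd (h.2 hγ) hg⟩
      have : g = g * γ * γ := by rw [mul_assoc, hexp γ, mul_one]
      rw [this]; exact H.mul_mem h hγ
    · refine ⟨fun _ => ⟨fun h => absurd h hg, fun h => absurd h hγ⟩, fun _ => ?_⟩
      have h1 := H.mul_mem ((hnotH g).1 hg) ((hnotH γ).1 hγ)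
      have : ρ * g * (ρ * γ) = g * γ := by
        rw [mul_mul_mul_comm, hρρ, one_mul]
      rwa [this] at h1
  -- counting: `|G| = 8`, the blocks `a = |Ψ ∩ H|`, `b = |Ψ ∩ ρH|`, `a + b = 4`
  have hcardG : Fintype.card (K ≃ₐ[ℚ] K) = 8 := by
    rw [← Nat.card_eq_fintype_card, IsGalois.card_aut_eq_finrank, h8]
  set a := (Ψ.filter fun g => g ∈ H).card with hadef
  set b := (Ψ.filter fun g => g ∉ H).card with hbdef
  have hab : a + b = Ψ.card := by
    rw [hadef, hbdef]; convert Finset.card_filter_add_card_filter_not (s := Ψ) (fun g => g ∈ H)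
  have hΨcard : Ψ.card = 4 := by
    -- `g ↦ ρ g` is a bijection `Ψ → G \\ Ψ`
    have h1 : Ψ.card = (Finset.univ.filter fun g : K ≃ₐ[ℚ] K => g ∉ Ψ).card := by
      refine Finset.card_nbij' (fun g => ρ * g) (fun g => ρ * g) ?_ ?_ ?_ ?_
      · intro g hg
        rw [Finset.mem_coe] at hg
        rw [Finset.mem_coe, Finset.mem_filter]
        exact ⟨Finset.mem_univ _, (hΨ.mem_iff g).1 hg⟩
      · intro g hg
        rw [Finset.mem_coe, Finset.mem_filter] at hg
        rw [Finset.mem_coe]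
        have h1 : ρ • (ρ * g) = g := by rw [smul_eq_mul, ← mul_assoc, hρρ, one_mul]
        have h2 := (hΨ.mem_iff (ρ * g)).2
        rw [h1] at h2
        exact h2 hg.2
      · intro g _; show ρ * (ρ * g) = g; rw [← mul_assoc, hρρ, one_mul]
      · intro g _; show ρ * (ρ * g) = g; rw [← mul_assoc, hρρ, one_mul]
    have h2 : Ψ.card + (Finset.univ.filter fun g : K ≃ₐ[ℚ] K => g ∉ Ψ).card = 8 := by
      have h3 : (Finset.univ.filter fun g : K ≃ₐ[ℚ] K => g ∈ Ψ) = Ψ := by ext g; simp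
      have := Finset.card_filter_add_card_filter_not (s := (Finset.univ : Finset (K ≃ₐ[ℚ] K))) (fun g => g ∈ Ψ)
      rw [h3, Finset.card_univ, hcardG] at this
      convert this using 2
    omega
  -- `a ≠ b`: the odd character `ε_H` sees `Ψ`
  have hne : a ≠ b := by
    let ε : AddChar (Additive (K ≃ₐ[ℚ] K)) ℂ :=
      { toFun := fun u => if Additive.toMul u ∈ H then 1 else -1
        map_zero_eq_one' := by simp [H.one_mem]
        map_add_eq_mul' := fun u v => by
          show (if Additive.toMul u * Additive.toMul v ∈ H then (1 : ℂ) else -1) =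
            (if Additive.toMul u ∈ H then (1 : ℂ) else -1) * (if Additive.toMul v ∈ H then (1 : ℂ) else -1)
          by_cases hu : Additive.toMul u ∈ H <;> by_cases hv : Additive.toMul v ∈ H
          · rw [if_pos ((hpar _ _).2 ⟨fun _ => hv, fun _ => hu⟩), if_pos hu, if_pos hv, one_mul]
          · rw [if_neg (fun h => hv (((hpar _ _).1 h).1 hu)), if_pos hu, if_neg hv, one_mul]
          · rw [if_neg (fun h => hu (((hpar _ _).1 h).2 hv)), if_neg hu, if_pos hv, mul_one]
          · rw [if_pos ((hpar _ _).2 ⟨fun h => absurd h hu, fun h => absurd h hv⟩), if_neg hu, if_neg hv]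
            norm_num }
    have hερ : ε (Additive.ofMul ρ) = -1 := by
      show (if Additive.toMul (Additive.ofMul ρ) ∈ H then (1 : ℂ) else -1) = -1
      rw [toMul_ofMul, if_neg hρH]
    have hsum := hndχ ε hερ
    have hval : ∑ g ∈ Ψ, ε (Additive.ofMul g) = (a : ℂ) - (b : ℂ) := by
      have : ∀ g, ε (Additive.ofMul g) = if g ∈ H then (1 : ℂ) else -1 := fun g => by
        show (if Additive.toMul (Additive.ofMul g) ∈ H then (1 : ℂ) else -1) = _
        rw [toMul_ofMul]
      simp_rw [this]
      rw [Finset.sum_ite, Finset.sum_const, Finset.sum_const, nsmul_eq_mul, nsmul_eq_mul, mul_one, mul_neg, mul_one,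
        hadef, hbdef, sub_eq_add_neg]
    intro heq
    apply hsum
    rw [hval, heq, sub_self]
  -- `Ψ` is not a coset of `H`: `b ≠ 0` and `a ≠ 0`
  obtain ⟨h₀, hh₀H, hh₀⟩ : ∃ h₀ : K ≃ₐ[ℚ] K, h₀ ∈ H ∧ h₀ ≠ 1 := by
    have hlt : (({1, ρ} : Finset (K ≃ₐ[ℚ] K))).card < (Finset.univ : Finset (K ≃ₐ[ℚ] K)).card := by
      have h2 : (({1, ρ} : Finset (K ≃ₐ[ℚ] K))).card ≤ 2 := Finset.card_le_two
      rw [Finset.card_univ]; omega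
    obtain ⟨g, -, hg⟩ := Finset.exists_mem_notMem_of_card_lt_card hlt
    rw [Finset.mem_insert, Finset.mem_singleton, not_or] at hg
    rcases hdich g with ⟨hgH, -⟩ | ⟨hρgH, -⟩
    · exact ⟨g, hgH, hg.1⟩
    · refine ⟨ρ * g, hρgH, fun h => hg.2 ?_⟩
      have : g = ρ * (ρ * g) := by rw [← mul_assoc, hρρ, one_mul]
      rw [this, h, mul_one]
  obtain ⟨χ, hχρ, hχh₀⟩ := exists_oddCharacter_apply_ne_one (G := K ≃ₐ[ℚ] K)
    (fun h => hρH (by rw [h]; exact H.one_mem)) hρρ hh₀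
  have hcoset : ∀ c : K ≃ₐ[ℚ] K, Ψ ≠ Finset.univ.filter (fun g => g * c ∈ H) := by
    intro c hc
    apply hndχ χ hχρ
    rw [← hΨdef, hc]
    exact sum_character_filter_mul_mem_eq_zero H χ hh₀H hχh₀ c
  -- `|H| = |ρH| = 4`
  have hHcard : (Finset.univ.filter fun g : K ≃ₐ[ℚ] K => g ∈ H).card = 4 ∧
      (Finset.univ.filter fun g : K ≃ₐ[ℚ] K => g ∉ H).card = 4 := by
    have h1 : (Finset.univ.filter fun g : K ≃ₐ[ℚ] K => g ∈ H).card =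
        (Finset.univ.filter fun g : K ≃ₐ[ℚ] K => g ∉ H).card := by
      refine Finset.card_nbij' (fun g => ρ * g) (fun g => ρ * g) ?_ ?_ ?_ ?_
      · intro g hg
        rw [Finset.mem_coe, Finset.mem_filter] at hg ⊢
        exact ⟨Finset.mem_univ _, hnotboth g hg.2⟩
      · intro g hg
        rw [Finset.mem_coe, Finset.mem_filter] at hg ⊢
        exact ⟨Finset.mem_univ _, (hnotH g).1 hg.2⟩
      · intro g _; show ρ * (ρ * g) = g; rw [← mul_assoc, hρρ, one_mul]
      · intro g _; show ρ * (ρ * g) = g; rw [← mul_assoc, hρρ, one_mul]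
    have h2 : (Finset.univ.filter fun g : K ≃ₐ[ℚ] K => g ∈ H).card +
        (Finset.univ.filter fun g : K ≃ₐ[ℚ] K => g ∉ H).card = 8 := by
      have := Finset.card_filter_add_card_filter_not (s := (Finset.univ : Finset (K ≃ₐ[ℚ] K))) (fun g => g ∈ H)
      rw [Finset.card_univ, hcardG] at this
      convert this using 2
    omega
  have hb0 : b ≠ 0 := by
    intro hb
    apply hcoset 1
    have hsub : Ψ ⊆ Finset.univ.filter fun g : K ≃ₐ[ℚ] K => g ∈ H := fun g hg => by
      rw [Finset.mem_filter]
      refine ⟨Finset.mem_univ _, ?_⟩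
      by_contra h
      have : g ∈ Ψ.filter fun g => g ∉ H := Finset.mem_filter.2 ⟨hg, h⟩
      rw [Finset.card_eq_zero.1 hb] at this
      exact absurd this (Finset.notMem_empty _)
    rw [Finset.eq_of_subset_of_card_le hsub (by rw [hHcard.1, hΨcard])]
    exact Finset.filter_congr fun g _ => by rw [mul_one]
  have ha0 : a ≠ 0 := by
    intro ha
    apply hcoset ρ
    have hsub : Ψ ⊆ Finset.univ.filter fun g : K ≃ₐ[ℚ] K => g ∉ H := fun g hg => by
      rw [Finset.mem_filter]
      refine ⟨Finset.mem_univ _, fun h => ?_⟩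
      have : g ∈ Ψ.filter fun g => g ∈ H := Finset.mem_filter.2 ⟨hg, h⟩
      rw [Finset.card_eq_zero.1 ha] at this
      exact absurd this (Finset.notMem_empty _)
    rw [Finset.eq_of_subset_of_card_le hsub (by rw [hHcard.2, hΨcard])]
    exact Finset.filter_congr fun g _ => by rw [hnotH, hcomm]
  have hcases : (a = 1 ∧ b = 3) ∨ (a = 3 ∧ b = 1) := by omega
  -- the coset `C = {h | h ∈ H ↔ a = 1}` with `|Ψ ∩ C| = 1`, and its translates
  have hcount : ∀ γ : K ≃ₐ[ℚ] K,
      (Finset.univ.filter fun h : K ≃ₐ[ℚ] K => (h ∈ H ↔ a = 1) ∧ h * γ ∈ Ψ).card = if γ ∈ H then 1 else 3 := by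
    intro γ
    rw [card_filter_mul_eq hexp γ (fun h => (h ∈ H ↔ a = 1)) (fun h => h ∈ Ψ)]
    have hre : ∀ (R : (K ≃ₐ[ℚ] K) → Prop) [DecidablePred fun g => R g ∧ g ∈ Ψ] [DecidablePred R],
        (Finset.univ.filter fun g : K ≃ₐ[ℚ] K => R g ∧ g ∈ Ψ) = Ψ.filter R := by
      intro R _ _; ext g; simp only [Finset.mem_filter, Finset.mem_univ, true_and, and_comm]
    rw [hre]
    by_cases hγ : γ ∈ H
    · rw [if_pos hγ]
      rcases hcases with ⟨ha, -⟩ | ⟨ha, hb⟩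
      · conv_rhs => rw [← ha]
        exact (congrArg Finset.card (Finset.filter_congr fun g _ => by rw [hpar]; simp [hγ, ha])).trans hadef.symm
      · conv_rhs => rw [← hb]
        exact (congrArg Finset.card (Finset.filter_congr fun g _ => by rw [hpar]; simp [hγ, ha])).trans hbdef.symm
    · rw [if_neg hγ]
      rcases hcases with ⟨ha, hb⟩ | ⟨ha, -⟩
      · conv_rhs => rw [← hb]
        exact (congrArg Finset.card (Finset.filter_congr fun g _ => by rw [hpar]; simp [hγ, ha])).trans hbdef.symm
      · conv_rhs => rw [← ha]
        exact (congrArg Finset.card (Finset.filter_congr fun g _ => by rw [hpar]; simp [hγ, ha])).trans hadef.symm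
  -- the witness weight on `E² × Y`
  let S₁ : Finset ((_ : Fin 2) × (k →+* ℂ)) := {⟨0, x⟩, ⟨1, x⟩}
  let emb : (K ≃ₐ[ℚ] K) → (_ : Fin 1) × (K →+* ℂ) := fun h => ⟨0, embOf φ₀ h⟩
  have hemb : Function.Injective emb := fun h h' hh => (embOf_bijective φ₀).1 (eq_of_heq (Sigma.mk.inj hh).2)
  let S₂ : Finset ((_ : Fin 1) × (K →+* ℂ)) := (Finset.univ.filter fun h : K ≃ₐ[ℚ] K => (h ∈ H ↔ a = 1)).image emb
  have hne01 : (⟨0, x⟩ : (_ : Fin 2) × (k →+* ℂ)) ≠ ⟨1, x⟩ := fun h => zero_ne_one ((Sigma.mk.inj_iff.mp h).1)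
  have hS1count : ∀ P : (k →+* ℂ) → Prop, {t | t ∈ S₁ ∧ P t.2}.ncard = if P x then 2 else 0 := by
    intro P
    by_cases hP : P x
    · rw [if_pos hP]
      have : {t | t ∈ S₁ ∧ P t.2} = ↑S₁ := by
        ext t
        simp only [Set.mem_setOf_eq, Finset.coe_insert, Finset.coe_singleton, Set.mem_insert_iff,
          Set.mem_singleton_iff, S₁, Finset.mem_insert, Finset.mem_singleton]
        constructor
        · exact fun h => h.1
        · rintro (rfl | rfl) <;> exact ⟨by tauto, hP⟩
      rw [this, Set.ncard_coe_finset, Finset.card_pair hne01]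
    · rw [if_neg hP]
      have : {t | t ∈ S₁ ∧ P t.2} = ∅ := by
        ext t
        simp only [Set.mem_setOf_eq, Set.mem_empty_iff_false, iff_false, not_and, S₁, Finset.mem_insert,
          Finset.mem_singleton]
        rintro (rfl | rfl) <;> exact hP
      rw [this, Set.ncard_empty]
  have hS2count : ∀ P : (K →+* ℂ) → Prop, {y | y ∈ S₂ ∧ P y.2}.ncard =
      (Finset.univ.filter fun h : K ≃ₐ[ℚ] K => (h ∈ H ↔ a = 1) ∧ P (embOf φ₀ h)).card := by
    intro P
    rw [ncard_sep_eq_card_filter, Finset.filter_image, Finset.card_image_of_injective _ hemb, Finset.filter_filter]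
  have hS2card : S₂.card = 4 := by
    rw [Finset.card_image_of_injective _ hemb]
    rcases hcases with ⟨ha, -⟩ | ⟨ha, -⟩
    · rw [← hHcard.1]; exact congrArg Finset.card (Finset.filter_congr fun g _ => by rw [ha]; simp)
    · rw [← hHcard.2]; exact congrArg Finset.card (Finset.filter_congr fun g _ => by rw [ha]; simp)
  -- `τ x ∈ Φ_k ↔ γ ∈ H` for `τ` acting through `γ`
  have hτx : ∀ (τ : ℂ ≃+* ℂ) (γ : K ≃ₐ[ℚ] K), (∀ z, τ (φ₀ z) = φ₀ (γ z)) →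
      ((τ : ℂ →+* ℂ).comp x ∈ Φk.1 ↔ γ ∈ H) := by
    intro τ γ hγ
    have h1 : (τ : ℂ →+* ℂ).comp x = φ₀.comp ((γ : K →+* K).comp j) := by
      refine RingHom.ext fun y => ?_
      rw [hcomp_apply, ← hγ (j y), ← hxy]
      rfl
    rw [h1]
    rcases hdich γ with ⟨hγH, hγx⟩ | ⟨hργH, hγx⟩
    · rw [hγx]; exact ⟨fun _ => hγH, fun _ => hxΦ⟩
    · rw [hγx, conjugate_mem_iff]
      exact ⟨fun h => absurd hxΦ h, fun h => absurd hργH (hnotboth γ h)⟩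
  -- the weight is Galois balanced with value `3`
  have hbal : ∀ τ : ℂ ≃+* ℂ,
      {z | z ∈ S₁.disjSum S₂ ∧ Sum.elim (fun t : (_ : Fin 2) × (k →+* ℂ) => (τ : ℂ →+* ℂ).comp t.2 ∈ Φk.1)
        (fun y : (_ : Fin 1) × (K →+* ℂ) => (τ : ℂ →+* ℂ).comp y.2 ∈ Φ.1) z}.ncard = 3 ∧
      {z | z ∈ S₁.disjSum S₂ ∧ ¬ Sum.elim (fun t : (_ : Fin 2) × (k →+* ℂ) => (τ : ℂ →+* ℂ).comp t.2 ∈ Φk.1)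
        (fun y : (_ : Fin 1) × (K →+* ℂ) => (τ : ℂ →+* ℂ).comp y.2 ∈ Φ.1) z}.ncard = 3 := by
    intro τ
    obtain ⟨γ, hγ⟩ := exists_algEquiv_comp_eq_smul φ₀ τ
    have hin : {z | z ∈ S₁.disjSum S₂ ∧ Sum.elim (fun t : (_ : Fin 2) × (k →+* ℂ) => (τ : ℂ →+* ℂ).comp t.2 ∈ Φk.1)
        (fun y : (_ : Fin 1) × (K →+* ℂ) => (τ : ℂ →+* ℂ).comp y.2 ∈ Φ.1) z}.ncard = 3 := by
      rw [ncard_sep_eq_add, Finset.toLeft_disjSum, Finset.toRight_disjSum]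
      simp only [Sum.elim_inl, Sum.elim_inr]
      rw [hS1count (fun s => (τ : ℂ →+* ℂ).comp s ∈ Φk.1), hS2count (fun s => (τ : ℂ →+* ℂ).comp s ∈ Φ.1)]
      have h2 : (Finset.univ.filter fun h : K ≃ₐ[ℚ] K => (h ∈ H ↔ a = 1) ∧ (τ : ℂ →+* ℂ).comp (embOf φ₀ h) ∈ Φ.1).card =
          (Finset.univ.filter fun h : K ≃ₐ[ℚ] K => (h ∈ H ↔ a = 1) ∧ h * γ ∈ Ψ).card := by
        refine congrArg Finset.card (Finset.filter_congr fun h _ => ?_)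
        have hsm : (τ : ℂ →+* ℂ).comp (embOf φ₀ h) = embOf φ₀ (h * γ) := by
          have := smul_embOf_of_comp φ₀ hγ h
          rwa [show γ⁻¹ = γ from inv_eq_of_mul_eq_one_right (hexp γ)] at this
        rw [hsm, hmemΨ]
      rw [h2, hcount γ, hτx τ γ hγ]
      split_ifs <;> rfl
    refine ⟨hin, ?_⟩
    have htot := ncard_add_ncard_not (S₁.disjSum S₂)
      (Sum.elim (fun t : (_ : Fin 2) × (k →+* ℂ) => (τ : ℂ →+* ℂ).comp t.2 ∈ Φk.1)
        (fun y : (_ : Fin 1) × (K →+* ℂ) => (τ : ℂ →+* ℂ).comp y.2 ∈ Φ.1))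
    rw [hin, Finset.card_disjSum, Finset.card_pair hne01, hS2card] at htot
    omega
  -- the product-span property on the square would balance the `E²`-block `{(0,x), (1,x)}`: absurd
  obtain ⟨p₁, p₂, -, h₁, -⟩ := blocksSplit_of_hodgeClassesProductSpan_biproduct (K := fun _ : Fin 2 => k)
    (K' := fun _ : Fin 1 => K) (Φ := fun _ => Φk) (Φ' := fun _ => Φ) (A := fun _ => E) (A' := fun _ => Y)
    (ι := fun _ => ιE) (ι' := fun _ => ιY) (θ := fun _ => θE) (θ' := fun _ => θY) (fun _ => hE) (fun _ => hY)
    hspan' (S₁.disjSum S₂) 3 hbal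
  rw [Finset.toLeft_disjSum] at h₁
  have hb := isGaloisBalancedAlg_iff.1 (mem_pohlmannSetsAlg_iff.1 h₁).2 1
  change {t | t ∈ S₁ ∧ ((1 : ℂ ≃+* ℂ) : ℂ →+* ℂ).comp t.2 ∈ Φk.1}.ncard =
    {t | t ∈ S₁ ∧ ¬ ((1 : ℂ ≃+* ℂ) : ℂ →+* ℂ).comp t.2 ∈ Φk.1}.ncard at hb
  rw [hS1count (fun s => ((1 : ℂ ≃+* ℂ) : ℂ →+* ℂ).comp s ∈ Φk.1),
    hS1count (fun s => ¬ ((1 : ℂ ≃+* ℂ) : ℂ →+* ℂ).comp s ∈ Φk.1)] at hb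
  have h1x : ((1 : ℂ ≃+* ℂ) : ℂ →+* ℂ).comp x = x := RingHom.ext fun _ => rfl
  rw [h1x, if_pos hxΦ, if_neg (not_not.2 hxΦ)] at hb
  exact absurd hb (by norm_num)

end Square

end Literature.AlgebraicGeometry.ComplexMultiplication.Multiquadratic

end
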